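import Summits.HodgeConjecture.CorCM.QuarticCMConjugationSquare
import Summits.HodgeConjecture.CorCM.IndependentCMFieldsHodge
import Literature.AlgebraicGeometry.Pohlmann1968.NondegenerateCMTypeDivisorGenerated
import HarnessLib

/-!
# `E^a × S^b` for a CM elliptic curve `E` and an abelian surface `S` with CM by a quartic CM field that is NOT Galois
# over `ℚ`: slotwise independence, nondegeneracy, `B• = D•`, and the Hodge conjecture — unconditionally

COR-CM (cell `pub-hodgecm2`, seat p2 gen 16, count-neutral claim IQD4); NEW as stated, hence under `Summits/`.  The
DIHEDRAL twin of `CorCM/ImaginaryQuadraticTimesCyclicCMHodge` (seat b23: second slot a CM field Galois over `ℚ` with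
CYCLIC group of order `≡ 0 (mod 4)`), in the same two-slot shape `(K_{i₀}, K_{i₁})`, `i₀ ≠ i₁`, `∀ j, j = i₀ ∨ j = i₁`:

* `K_{i₀}` an imaginary quadratic field (CM elliptic curves; every CM type nondegenerate,
  `Pohlmann1968.isNondegenerate_of_finrank_eq_two`), and
* `K_{i₁}` a QUARTIC CM field that is NOT Galois over `ℚ` (its Galois closure is dihedral of order `8`; every CM type
  of it is primitive and nondegenerate — `QuarticCM.isNondegenerate_of_not_isGalois`, seat b24 — and its abelian
  surfaces are simple).

By `CorCM/QuarticCMConjugationSquare` (`exists_ringAut_smul_eq_conjugate_smul_eq_self`: some automorphism of `ℂ` is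
complex conjugation on `Hom(K_{i₀}, ℂ)` and the identity on `Hom(K_{i₁}, ℂ)`), `Aut(ℂ)` acts slotwise independently on
the embeddings (`slotwiseIndependent_of_quadratic_of_not_isGalois`, via the abstract two-slot criterion); so EVERY family
of CM types `(Φ_{i₀}, Φ_{i₁})` is nondegenerate (`isNondegenerateFamily_of_quadratic_of_not_isGalois`), and every product
`⨁_{j<N} A_{π j}` — every `E^a × S^b` — of realisations has `Bᵐ ⊗ ℂ = Dᵐ ⊗ ℂ`
(`hodgeClassSpan_prod_eq_divisorClassesSpan_of_quadratic_of_not_isGalois`), carries no exotic Hodge class, and satisfies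
the Hodge conjecture (`hodgeConjectureFor_prod_of_quadratic_of_not_isGalois`) with NO hypothesis on the types and NO
named fact.  The Galois form `normalClosure_inf_iSup_eq_bot_of_quadratic_of_not_isGalois` records that the pair also
meets the hypothesis of `LinearlyDisjointCMFieldsHodge.hodgeConjectureFor_prod_of_normalClosure_inf_eq_bot`.

Together with the cyclic file this covers `E^a × S^b` for every CM elliptic curve `E` and every SIMPLE CM abelian
surface `S` whose (quartic) CM field is cyclic or non-Galois; a biquadratic CM field carries no primitive CM type.

Everything is a short application; theorems only (one private lattice lemma), no definition, no `sorry`.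

## References

* [Gordon1999HodgeAVSurvey] B. B. Gordon, *A survey of the Hodge conjecture for abelian varieties*, §3 Theorem (Imai,
  Murty) with proof; 7.5; 10.10.
* [Shimura1998] G. Shimura, *Abelian Varieties with Complex Multiplication and Modular Functions*, §8.4 (2).
* [MoonenZarhin1999LowDim] B. Moonen, Yu. Zarhin, Math. Ann. 315 (1999) 711–733, section "Hodge groups of simple
  abelian surfaces of CM-type".
-/

noncomputable section

open CategoryTheory CategoryTheory.Limits NumberField IntermediateField

namespace Summit.HodgeConjecture.CorCM

open Literature.NumberTheory.ComplexMultiplication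
open Literature.AlgebraicGeometry.Motives (AbelianVariety CMType)
open Literature.AlgebraicGeometry.HodgeTheory
open Literature.AlgebraicGeometry.ComplexMultiplication (IsCMTypeRealisation)
open Literature.AlgebraicGeometry.VanGeemen1994 (hodgeClassSpan)
open Literature.AlgebraicGeometry.Pohlmann1968
open Literature.Barriers.HodgeConjecture (divisorClassesSpan)

/-- In a two-element index type `{i₀, i₁}`, the supremum over the indices `≠ i₀` is the value at `i₁`. [folklore] -/
private theorem iSup_subtype_ne_eq' {I : Type} {α : Type*} [CompleteLattice α] {i₀ i₁ : I} (h01 : i₀ ≠ i₁)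
    (hI : ∀ j, j = i₀ ∨ j = i₁) (f : I → α) : (⨆ j : {j : I // j ≠ i₀}, f j.1) = f i₁ := by
  apply le_antisymm
  · refine iSup_le fun j => ?_
    obtain ⟨j, hj⟩ := j
    rcases hI j with rfl | rfl
    · exact absurd rfl hj
    · exact le_rfl
  · exact le_iSup (fun j : {j : I // j ≠ i₀} => f j.1) ⟨i₁, fun h => h01 h.symm⟩

section TwoSlots

variable {I : Type} {K : I → Type} [∀ i, Field (K i)] [∀ i, NumberField (K i)] [∀ i, IsCMField (K i)] [Fintype I]
  [Nonempty I]

omit [Fintype I] [Nonempty I] in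
/-- **The Galois closures of an imaginary quadratic field and of a non-Galois quartic CM field meet in `ℚ`, slot by
slot**: for the two-slot family `(K_{i₀}, K_{i₁})` the hypothesis of
`hodgeConjectureFor_prod_of_normalClosure_inf_eq_bot` holds. [cite: Shimura1998, §8.4 (2)] -/
theorem normalClosure_inf_iSup_eq_bot_of_quadratic_of_not_isGalois {i₀ i₁ : I} (h01 : i₀ ≠ i₁)
    (hI : ∀ j, j = i₀ ∨ j = i₁) (h0 : Module.finrank ℚ (K i₀) = 2) (h4 : Module.finrank ℚ (K i₁) = 4)
    (hK : ¬IsGalois ℚ (K i₁)) (i : I) :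
    normalClosure ℚ (K i) ℂ ⊓ (⨆ j : {j : I // j ≠ i}, normalClosure ℚ (K j.1) ℂ) = ⊥ := by
  rcases hI i with rfl | rfl
  · rw [iSup_subtype_ne_eq' h01 hI (fun j => normalClosure ℚ (K j) ℂ)]
    exact QuarticCM.normalClosure_inf_normalClosure_eq_bot_of_not_isGalois h0 h4 hK
  · rw [iSup_subtype_ne_eq' (Ne.symm h01) (fun j => (hI j).symm) (fun j => normalClosure ℚ (K j) ℂ)]
    exact QuarticCM.normalClosure_inf_normalClosure_eq_bot_of_not_isGalois' h0 h4 hK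

omit [Fintype I] [Nonempty I] in
/-- **Slotwise independence** of `Aut(ℂ)` on the embeddings of an imaginary quadratic field and a non-Galois quartic
CM field — directly from the automorphism of `ℂ` that is complex conjugation on `Hom(K_{i₀}, ℂ)` and the identity on
`Hom(K_{i₁}, ℂ)` (`QuarticCM.exists_ringAut_smul_eq_conjugate_smul_eq_self`) and the abstract two-slot criterion
`QuarticCM.slotwiseIndependent_of_two_slots`. [cite: Gordon1999HodgeAVSurvey, §3 Theorem (proof)] -/
theorem slotwiseIndependent_of_quadratic_of_not_isGalois {i₀ i₁ : I} (hI : ∀ j, j = i₀ ∨ j = i₁)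
    (h0 : Module.finrank ℚ (K i₀) = 2) (h4 : Module.finrank ℚ (K i₁) = 4) (hK : ¬IsGalois ℚ (K i₁)) :
    SlotwiseIndependent (ℂ ≃+* ℂ) fun i => K i →+* ℂ := by
  obtain ⟨τ₁, h₁, h₁'⟩ := QuarticCM.exists_ringAut_smul_eq_conjugate_smul_eq_self h0 h4 hK
  refine QuarticCM.slotwiseIndependent_of_two_slots (E := fun i => K i →+* ℂ) hI (starRingAut : ℂ ≃+* ℂ) τ₁
    (fun g => ?_) (fun s => ?_) (fun s => ?_) h₁'
  · rcases QuarticCM.smul_eq_self_or_eq_conjugate_of_finrank_eq_two h0 g with h | h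
    · exact Or.inl h
    · exact Or.inr fun s => by rw [h, conj_smul_eq_conjugate]
  · change (starRingAut : ℂ ≃+* ℂ) • (starRingAut : ℂ ≃+* ℂ) • s = s
    rw [conj_smul_eq_conjugate, conj_smul_eq_conjugate, ComplexEmbedding.involutive_conjugate (K i₀) s]
  · change τ₁ • s = (starRingAut : ℂ ≃+* ℂ) • s
    rw [h₁, conj_smul_eq_conjugate]

/-- **Additivity of the rank**: `cmFamilyRank Φ + 2 = cmTypeRank Φ_{i₀} + cmTypeRank Φ_{i₁} + 1` for the two-slot
family, i.e. `rank Hg(E × S) = rank Hg(E) + rank Hg(S)`. [cite: Gordon1999HodgeAVSurvey, §3 Theorem (1)] -/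
theorem cmFamilyRank_add_card_eq_of_quadratic_of_not_isGalois {i₀ i₁ : I} (hI : ∀ j, j = i₀ ∨ j = i₁)
    (h0 : Module.finrank ℚ (K i₀) = 2) (h4 : Module.finrank ℚ (K i₁) = 4)
    (hK : ¬IsGalois ℚ (K i₁)) (Φ : ∀ i, CMType (K i)) :
    CMAlgebra.cmFamilyRank Φ + Fintype.card I = (∑ i, cmTypeRank (Φ i)) + 1 :=
  cmFamilyRank_add_card_eq (slotwiseIndependent_of_quadratic_of_not_isGalois hI h0 h4 hK) Φ

omit [Fintype I] [Nonempty I] in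
/-- Both types of the two-slot family are nondegenerate, whatever they are: a CM type of an imaginary quadratic field
(`Pohlmann1968.isNondegenerate_of_finrank_eq_two`) and a CM type of a non-Galois quartic CM field
(`QuarticCM.isNondegenerate_of_not_isGalois`). [cite: Shimura1998, §8.4 (2)] -/
theorem forall_isNondegenerate_of_quadratic_of_not_isGalois {i₀ i₁ : I} (hI : ∀ j, j = i₀ ∨ j = i₁)
    (h0 : Module.finrank ℚ (K i₀) = 2) (h4 : Module.finrank ℚ (K i₁) = 4) (hK : ¬IsGalois ℚ (K i₁))
    (Φ : ∀ i, CMType (K i)) : ∀ i, IsNondegenerate (Φ i) := by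
  intro i
  rcases hI i with rfl | rfl
  · exact isNondegenerate_of_finrank_eq_two (Φ _) h0
  · exact QuarticCM.isNondegenerate_of_not_isGalois h4 hK (Φ _)

/-- **Every family of CM types of the two-slot family is nondegenerate** (`E × S` is stably nondegenerate for every
CM elliptic curve `E` with CM by `K_{i₀}` and every abelian surface `S` with CM by the non-Galois quartic `K_{i₁}`).
[cite: Gordon1999HodgeAVSurvey, §3 Theorem and 7.5] -/
theorem isNondegenerateFamily_of_quadratic_of_not_isGalois {i₀ i₁ : I} (hI : ∀ j, j = i₀ ∨ j = i₁)
    (h0 : Module.finrank ℚ (K i₀) = 2) (h4 : Module.finrank ℚ (K i₁) = 4) (hK : ¬IsGalois ℚ (K i₁))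
    (Φ : ∀ i, CMType (K i)) : CMAlgebra.IsNondegenerateFamily Φ :=
  (isNondegenerateFamily_iff_forall_isNondegenerate (slotwiseIndependent_of_quadratic_of_not_isGalois hI h0 h4 hK)
    Φ).2 (forall_isNondegenerate_of_quadratic_of_not_isGalois hI h0 h4 hK Φ)

variable {Φ : ∀ i, CMType (K i)}
variable {A : I → AbelianVariety ℂ} {ι : ∀ i, 𝓞 (K i) →+* End (A i)}
  {θ : ∀ i, K i →+* Module.End ℂ (complexBetti (A i).X 1)}

/-- **`Bᵐ ⊗ ℂ = Dᵐ ⊗ ℂ` on every `E^a × S^b`** (every product `⨁_{j<N} A_{π j}` of realisations): `E` a CM elliptic curve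
with CM by the imaginary quadratic `K_{i₀}`, `S` an abelian surface with CM by the non-Galois quartic CM field
`K_{i₁}` (any CM types). [cite: Gordon1999HodgeAVSurvey, §3 Theorem (2) and 7.5] -/
theorem hodgeClassSpan_prod_eq_divisorClassesSpan_of_quadratic_of_not_isGalois {i₀ i₁ : I}
    (hI : ∀ j, j = i₀ ∨ j = i₁) (h0 : Module.finrank ℚ (K i₀) = 2) (h4 : Module.finrank ℚ (K i₁) = 4)
    (hK : ¬IsGalois ℚ (K i₁)) (hA : ∀ i, IsCMTypeRealisation (Φ i) (A i) (ι i) (θ i)) {N : ℕ} (π : Fin N → I)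
    (m : ℕ) :
    hodgeClassSpan (⨁ fun j : Fin N => A (π j)).dim (⨁ fun j : Fin N => A (π j)).X m =
      divisorClassesSpan (⨁ fun j : Fin N => A (π j)).X (⨁ fun j : Fin N => A (π j)).dim m :=
  hodgeClassSpan_prod_eq_divisorClassesSpan_of_slotwiseIndependent
    (slotwiseIndependent_of_quadratic_of_not_isGalois hI h0 h4 hK)
    (forall_isNondegenerate_of_quadratic_of_not_isGalois hI h0 h4 hK Φ) hA π m

/-- **No `E^a × S^b` of this kind supports an exotic Hodge class.** [cite: Gordon1999HodgeAVSurvey, §3 Theorem (2) and 7.5] -/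
theorem not_exists_exceptional_prod_of_quadratic_of_not_isGalois {i₀ i₁ : I} (hI : ∀ j, j = i₀ ∨ j = i₁)
    (h0 : Module.finrank ℚ (K i₀) = 2) (h4 : Module.finrank ℚ (K i₁) = 4)
    (hK : ¬IsGalois ℚ (K i₁)) (hA : ∀ i, IsCMTypeRealisation (Φ i) (A i) (ι i) (θ i)) {N : ℕ} (π : Fin N → I)
    (m : ℕ) :
    ¬∃ c : complexBetti (⨁ fun j : Fin N => A (π j)).X (2 * m), IsRationalClass c ∧
        IsOfHodgeType (⨁ fun j : Fin N => A (π j)).dim (⨁ fun j : Fin N => A (π j)).X (2 * m) m m c ∧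
        c ∉ divisorClassesSpan (⨁ fun j : Fin N => A (π j)).X (⨁ fun j : Fin N => A (π j)).dim m :=
  not_exists_exceptional_prod_of_slotwiseIndependent (slotwiseIndependent_of_quadratic_of_not_isGalois hI h0 h4 hK)
    (forall_isNondegenerate_of_quadratic_of_not_isGalois hI h0 h4 hK Φ) hA π m

/-- **The Hodge conjecture for every `E^a × S^b`** (every product `⨁_{j<N} A_{π j}` of realisations of the two-slot
family): `E` a CM elliptic curve with CM by an imaginary quadratic field `K_{i₀}`, `S` an abelian surface with CM by a
QUARTIC CM field `K_{i₁}` that is NOT Galois over `ℚ`, ANY CM types, UNCONDITIONAL — no named fact.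
[cite: Gordon1999HodgeAVSurvey, §3 Theorem and 10.10] [cite: Shimura1998, §8.4 (2)] -/
theorem hodgeConjectureFor_prod_of_quadratic_of_not_isGalois {i₀ i₁ : I} (hI : ∀ j, j = i₀ ∨ j = i₁)
    (h0 : Module.finrank ℚ (K i₀) = 2) (h4 : Module.finrank ℚ (K i₁) = 4) (hK : ¬IsGalois ℚ (K i₁))
    (hA : ∀ i, IsCMTypeRealisation (Φ i) (A i) (ι i) (θ i)) {N : ℕ} (π : Fin N → I) :
    HodgeConjectureFor (⨁ fun j : Fin N => A (π j)).dim (⨁ fun j : Fin N => A (π j)).X :=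
  hodgeConjectureFor_prod_of_slotwiseIndependent (slotwiseIndependent_of_quadratic_of_not_isGalois hI h0 h4 hK)
    (forall_isNondegenerate_of_quadratic_of_not_isGalois hI h0 h4 hK Φ) hA π

end TwoSlots

end Summit.HodgeConjecture.CorCM

end
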